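import Mathlib.Analysis.SpecialFunctions.Exp
import Mathlib.Analysis.SpecialFunctions.Log.Basic
import Mathlib.Analysis.Complex.ExponentialBounds
import Literature.Computability.Complexity.AverageCaseDepthHierarchyLevel
import HarnessLib

/-!
# Chernoff bounds for counts of independent block events (RST Fact 1, as used in §10.1)

B. Rossman, R. A. Servedio, L.-Y. Tan, *An average-case depth hierarchy theorem for Boolean
circuits*, arXiv:1504.03398 [RossmanServedioTan2015], §5.1 Fact 1 (p. 13, the multiplicative
Chernoff bounds for sums of independent `[0,1]`-valued random variables) and its uses in §10.1
(Lemmas 10, 12, 14, 16 and eq. (27): the number of starred children of a gate, and the number of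
determined gates in a block, are concentrated, "by Fact 1", because the blocks of an RST random
projection are independent).

Everything is over FINITE weighted spaces (no measure theory): a weight `μ ≥ 0` on a `Fintype`,
a count `N`, and the hypothesis that the exponential moments FACTORISE,
`Σ_x μ x e^{θ N x} = ∏_{b ∈ B} (1 + p_b (e^θ - 1))` — which is what independence of the events
counted by `N` means, and which `mgf_count_blocks` / `mgf_count_groups` establish for counts of
events attached to distinct blocks (resp. disjoint groups of blocks) of a product weight
`∏_a ζ_a`. From the factorisation, `1 + y ≤ e^y` and `e^θ ≤ 1 + θ + θ²` (`|θ| ≤ 1`) give the three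
tail bounds used by RST (with cruder constants than Fact 1, which is all that is needed):

* `weight_ge_le_of_mgf`      : `P[N ≥ M + Δ] ≤ e^{-Δ²/(4M)}`   (`Σ p ≤ M`, `0 ≤ Δ ≤ 2M`);
* `weight_le_le_of_mgf`      : `P[N ≤ M - Δ] ≤ e^{-Δ²/(4M)}`   (`M ≤ Σ p`, `0 ≤ Δ ≤ 2M`);
* `weight_ge_le_of_mgf_large`: `P[N ≥ a] ≤ e^{2M - a}`         (`Σ p ≤ M`).
-/

noncomputable section

namespace Literature.Computability.Complexity

namespace RSTProj

open Finset Real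

/-! ### Tail bounds from a factorised exponential moment -/

section Tails

variable {Ω β : Type*} [Fintype Ω]

/-- `1 + p (e^θ - 1) ≤ exp (p (e^θ - 1))`, and the product over the events. [folklore] -/
theorem prod_one_add_mul_le_exp (B : Finset β) (p : β → ℝ) (x : ℝ) :
    (∀ b ∈ B, 0 ≤ 1 + p b * x) → ∏ b ∈ B, (1 + p b * x) ≤ Real.exp (x * ∑ b ∈ B, p b) := by
  classical
  intro h
  rw [Finset.mul_sum, Real.exp_sum]
  refine Finset.prod_le_prod (fun b hb => h b hb) fun b _ => ?_
  have := Real.add_one_le_exp (p b * x)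
  rw [mul_comm x]; linarith

/-- **Markov on the exponential moment, upper tail**: for `θ ≥ 0`,
`P[N ≥ a] ≤ e^{-θ a} Σ μ e^{θ N}`. [cite: RossmanServedioTan2015, §5.1 Fact 1 (p. 13)] -/
theorem weight_ge_le_mgf (μ : Ω → ℝ) (hμ : ∀ x, 0 ≤ μ x) (N : Ω → ℕ) {θ : ℝ} (hθ : 0 ≤ θ) (a : ℝ) :
    ∑ x ∈ univ.filter (fun x => a ≤ N x), μ x ≤ Real.exp (-(θ * a)) * ∑ x, μ x * Real.exp (θ * N x) := by
  classical
  rw [Finset.mul_sum]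
  calc ∑ x ∈ univ.filter (fun x => a ≤ N x), μ x
      ≤ ∑ x ∈ univ.filter (fun x => a ≤ N x), Real.exp (-(θ * a)) * (μ x * Real.exp (θ * N x)) := by
        refine Finset.sum_le_sum fun x hx => ?_
        have hax : a ≤ N x := (Finset.mem_filter.1 hx).2
        have : 1 ≤ Real.exp (-(θ * a)) * Real.exp (θ * N x) := by
          rw [← Real.exp_add]
          exact Real.one_le_exp (by nlinarith)
        calc μ x = μ x * 1 := (mul_one _).symm
          _ ≤ μ x * (Real.exp (-(θ * a)) * Real.exp (θ * N x)) := mul_le_mul_of_nonneg_left this (hμ x)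
          _ = _ := by ring
    _ ≤ ∑ x, Real.exp (-(θ * a)) * (μ x * Real.exp (θ * N x)) :=
        Finset.sum_le_sum_of_subset_of_nonneg (Finset.filter_subset _ _) fun x _ _ => by
          have := hμ x; positivity

/-- **Markov on the exponential moment, lower tail**: for `θ ≥ 0`,
`P[N ≤ a] ≤ e^{θ a} Σ μ e^{-θ N}`. [cite: RossmanServedioTan2015, §5.1 Fact 1 (p. 13)] -/
theorem weight_le_le_mgf (μ : Ω → ℝ) (hμ : ∀ x, 0 ≤ μ x) (N : Ω → ℕ) {θ : ℝ} (hθ : 0 ≤ θ) (a : ℝ) :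
    ∑ x ∈ univ.filter (fun x => (N x : ℝ) ≤ a), μ x ≤ Real.exp (θ * a) * ∑ x, μ x * Real.exp (-θ * N x) := by
  classical
  rw [Finset.mul_sum]
  calc ∑ x ∈ univ.filter (fun x => (N x : ℝ) ≤ a), μ x
      ≤ ∑ x ∈ univ.filter (fun x => (N x : ℝ) ≤ a), Real.exp (θ * a) * (μ x * Real.exp (-θ * N x)) := by
        refine Finset.sum_le_sum fun x hx => ?_
        have hax : (N x : ℝ) ≤ a := (Finset.mem_filter.1 hx).2
        have : 1 ≤ Real.exp (θ * a) * Real.exp (-θ * N x) := by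
          rw [← Real.exp_add]
          exact Real.one_le_exp (by nlinarith)
        calc μ x = μ x * 1 := (mul_one _).symm
          _ ≤ μ x * (Real.exp (θ * a) * Real.exp (-θ * N x)) := mul_le_mul_of_nonneg_left this (hμ x)
          _ = _ := by ring
    _ ≤ ∑ x, Real.exp (θ * a) * (μ x * Real.exp (-θ * N x)) :=
        Finset.sum_le_sum_of_subset_of_nonneg (Finset.filter_subset _ _) fun x _ _ => by
          have := hμ x; positivity

/-- `e^θ ≤ 1 + θ + θ²` for `|θ| ≤ 1`. [folklore] -/
theorem exp_le_one_add_add_sq {θ : ℝ} (hθ : |θ| ≤ 1) : Real.exp θ ≤ 1 + θ + θ ^ 2 := by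
  have h := Real.abs_exp_sub_one_sub_id_le hθ
  have := (abs_le.1 h).2
  linarith

/-- **Upper tail, moderate deviations**: if the exponential moments of `N` factorise with event
probabilities `p_b ∈ [0,1]` of total at most `M > 0`, then `P[N ≥ M + Δ] ≤ e^{-Δ²/(4M)}` for
`0 ≤ Δ ≤ 2M`. [cite: RossmanServedioTan2015, §5.1 Fact 1 (p. 13, first bound)] -/
theorem weight_ge_le_of_mgf (μ : Ω → ℝ) (hμ : ∀ x, 0 ≤ μ x) (N : Ω → ℕ) (B : Finset β) (p : β → ℝ)
    (hp0 : ∀ b ∈ B, 0 ≤ p b)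
    (hmgf : ∀ θ : ℝ, ∑ x, μ x * Real.exp (θ * N x) = ∏ b ∈ B, (1 + p b * (Real.exp θ - 1)))
    {M Δ : ℝ} (hM : 0 < M) (hpM : ∑ b ∈ B, p b ≤ M) (hΔ0 : 0 ≤ Δ) (hΔ : Δ ≤ 2 * M) :
    ∑ x ∈ univ.filter (fun x => M + Δ ≤ N x), μ x ≤ Real.exp (-(Δ ^ 2 / (4 * M))) := by
  set θ := Δ / (2 * M) with hθ
  have hθ0 : 0 ≤ θ := div_nonneg hΔ0 (by linarith)
  have hθ1 : θ ≤ 1 := by rw [hθ, div_le_one (by linarith)]; exact hΔ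
  have hexp : Real.exp θ - 1 ≤ θ + θ ^ 2 := by
    have := exp_le_one_add_add_sq (θ := θ) (by rw [abs_of_nonneg hθ0]; exact hθ1)
    linarith
  have hx0 : 0 ≤ Real.exp θ - 1 := by have := Real.one_le_exp hθ0; linarith
  have h1 := weight_ge_le_mgf μ hμ N hθ0 (M + Δ)
  rw [hmgf θ] at h1
  have h2 : ∏ b ∈ B, (1 + p b * (Real.exp θ - 1)) ≤ Real.exp ((Real.exp θ - 1) * ∑ b ∈ B, p b) :=
    prod_one_add_mul_le_exp B p _ fun b hb => by have := hp0 b hb; positivity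
  have h3 : Real.exp ((Real.exp θ - 1) * ∑ b ∈ B, p b) ≤ Real.exp ((θ + θ ^ 2) * M) := by
    rw [Real.exp_le_exp]
    exact mul_le_mul hexp hpM (Finset.sum_nonneg hp0) (by positivity)
  calc ∑ x ∈ univ.filter (fun x => M + Δ ≤ N x), μ x
      ≤ Real.exp (-(θ * (M + Δ))) * Real.exp ((θ + θ ^ 2) * M) :=
        h1.trans (mul_le_mul_of_nonneg_left (h2.trans h3) (Real.exp_pos _).le)
    _ = Real.exp (-(Δ ^ 2 / (4 * M))) := by
        rw [← Real.exp_add]; congr 1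
        rw [hθ]; field_simp; ring

/-- **Lower tail, moderate deviations**: with event probabilities of total at least `M > 0`,
`P[N ≤ M - Δ] ≤ e^{-Δ²/(4M)}` for `0 ≤ Δ ≤ 2M`. [cite: RossmanServedioTan2015, §5.1 Fact 1 (p. 13, second bound)] -/
theorem weight_le_le_of_mgf (μ : Ω → ℝ) (hμ : ∀ x, 0 ≤ μ x) (N : Ω → ℕ) (B : Finset β) (p : β → ℝ)
    (hp1 : ∀ b ∈ B, p b ≤ 1)
    (hmgf : ∀ θ : ℝ, ∑ x, μ x * Real.exp (θ * N x) = ∏ b ∈ B, (1 + p b * (Real.exp θ - 1)))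
    {M Δ : ℝ} (hM : 0 < M) (hpM : M ≤ ∑ b ∈ B, p b) (hΔ0 : 0 ≤ Δ) (hΔ : Δ ≤ 2 * M) :
    ∑ x ∈ univ.filter (fun x => (N x : ℝ) ≤ M - Δ), μ x ≤ Real.exp (-(Δ ^ 2 / (4 * M))) := by
  set θ := Δ / (2 * M) with hθ
  have hθ0 : 0 ≤ θ := div_nonneg hΔ0 (by linarith)
  have hθ1 : θ ≤ 1 := by rw [hθ, div_le_one (by linarith)]; exact hΔ
  have hexp : Real.exp (-θ) - 1 ≤ -θ + θ ^ 2 := by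
    have := exp_le_one_add_add_sq (θ := -θ) (by rw [abs_neg, abs_of_nonneg hθ0]; exact hθ1)
    nlinarith
  have hxneg : Real.exp (-θ) - 1 ≤ 0 := by
    have := Real.exp_le_one_iff.2 (neg_nonpos.2 hθ0); linarith
  have hx1 : ∀ b ∈ B, 0 ≤ 1 + p b * (Real.exp (-θ) - 1) := by
    intro b hb
    have : p b * (1 - Real.exp (-θ)) ≤ 1 * 1 :=
      mul_le_mul (hp1 b hb) (by have := Real.exp_pos (-θ); linarith) (by linarith) zero_le_one
    nlinarith
  have h1 := weight_le_le_mgf μ hμ N hθ0 (M - Δ)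
  have hm : ∑ x, μ x * Real.exp (-θ * N x) = ∏ b ∈ B, (1 + p b * (Real.exp (-θ) - 1)) := hmgf (-θ)
  rw [hm] at h1
  have h2 : ∏ b ∈ B, (1 + p b * (Real.exp (-θ) - 1)) ≤ Real.exp ((Real.exp (-θ) - 1) * ∑ b ∈ B, p b) :=
    prod_one_add_mul_le_exp B p _ hx1
  have h3 : Real.exp ((Real.exp (-θ) - 1) * ∑ b ∈ B, p b) ≤ Real.exp ((-θ + θ ^ 2) * M) := by
    rw [Real.exp_le_exp]
    calc (Real.exp (-θ) - 1) * ∑ b ∈ B, p b ≤ (Real.exp (-θ) - 1) * M :=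
          mul_le_mul_of_nonpos_left hpM hxneg
      _ ≤ (-θ + θ ^ 2) * M := mul_le_mul_of_nonneg_right hexp hM.le
  calc ∑ x ∈ univ.filter (fun x => (N x : ℝ) ≤ M - Δ), μ x
      ≤ Real.exp (θ * (M - Δ)) * Real.exp ((-θ + θ ^ 2) * M) :=
        h1.trans (mul_le_mul_of_nonneg_left (h2.trans h3) (Real.exp_pos _).le)
    _ = Real.exp (-(Δ ^ 2 / (4 * M))) := by
        rw [← Real.exp_add]; congr 1
        rw [hθ]; field_simp; ring

/-- **Upper tail, large deviations**: `P[N ≥ a] ≤ e^{2M - a}` when the event probabilities total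
at most `M`. [cite: RossmanServedioTan2015, §5.1 Fact 1 (p. 13, first bound with `γ ≥ 1`)] -/
theorem weight_ge_le_of_mgf_large (μ : Ω → ℝ) (hμ : ∀ x, 0 ≤ μ x) (N : Ω → ℕ) (B : Finset β) (p : β → ℝ)
    (hp0 : ∀ b ∈ B, 0 ≤ p b)
    (hmgf : ∀ θ : ℝ, ∑ x, μ x * Real.exp (θ * N x) = ∏ b ∈ B, (1 + p b * (Real.exp θ - 1)))
    {M : ℝ} (hpM : ∑ b ∈ B, p b ≤ M) (a : ℝ) :
    ∑ x ∈ univ.filter (fun x => a ≤ N x), μ x ≤ Real.exp (2 * M - a) := by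
  have h1 := weight_ge_le_mgf μ hμ N zero_le_one a
  rw [hmgf 1] at h1
  simp only [one_mul] at h1
  have he : Real.exp 1 - 1 ≤ 2 := by have := Real.exp_one_lt_d9; norm_num at this; linarith
  have hx0 : 0 ≤ Real.exp 1 - 1 := by have := Real.one_le_exp zero_le_one; linarith
  have h2 : ∏ b ∈ B, (1 + p b * (Real.exp 1 - 1)) ≤ Real.exp ((Real.exp 1 - 1) * ∑ b ∈ B, p b) :=
    prod_one_add_mul_le_exp B p _ fun b hb => by have := hp0 b hb; positivity
  have h3 : Real.exp ((Real.exp 1 - 1) * ∑ b ∈ B, p b) ≤ Real.exp (2 * M) := by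
    rw [Real.exp_le_exp]
    exact mul_le_mul he hpM (Finset.sum_nonneg hp0) (by norm_num)
  calc ∑ x ∈ univ.filter (fun x => a ≤ N x), μ x
      ≤ Real.exp (-a) * Real.exp (2 * M) := h1.trans (mul_le_mul_of_nonneg_left (h2.trans h3) (Real.exp_pos _).le)
    _ = Real.exp (2 * M - a) := by rw [← Real.exp_add]; congr 1; ring

end Tails

/-! ### Factorised exponential moments of counts of block events -/

section MGF

variable {A X : Type*} [Fintype A] [DecidableEq A] [Fintype X]

/-- **Independence of the blocks**: under a product weight `∏_a ζ_a(ρ_a)` with `Σ_x ζ_a x = 1`, the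
exponential moment of the number of blocks `b ∈ B` whose string satisfies `f b` factorises, with
`p_b = ζ_b{f b}`. [cite: RossmanServedioTan2015, §10.1 (pp. 31–34, "by independence") with §7.2 Defs. 6, 9 ("independently for each `a`")] -/
theorem mgf_count_blocks (ζ : A → X → ℝ) (hζ1 : ∀ a, ∑ x, ζ a x = 1) (B : Finset A)
    (f : A → X → Prop) [∀ a x, Decidable (f a x)] (θ : ℝ) :
    ∑ ρ : A → X, (∏ a, ζ a (ρ a)) * Real.exp (θ * ((B.filter fun b => f b (ρ b)).card : ℕ)) =
      ∏ b ∈ B, (1 + (∑ x ∈ univ.filter (fun x => f b x), ζ b x) * (Real.exp θ - 1)) := by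
  classical
  -- the exponential of the count is a product of block factors
  have hexp : ∀ ρ : A → X, Real.exp (θ * ((B.filter fun b => f b (ρ b)).card : ℕ)) =
      ∏ a, (if a ∈ B then (if f a (ρ a) then Real.exp θ else 1) else 1) := by
    intro ρ
    rw [Finset.prod_ite_mem, Finset.univ_inter, Finset.prod_ite, Finset.prod_const_one, mul_one,
      Finset.prod_const, ← Real.exp_nat_mul, mul_comm]
  have h := Finset.prod_univ_sum (fun (_ : A) => (univ : Finset X))
    (fun a x => ζ a x * (if a ∈ B then (if f a x then Real.exp θ else 1) else 1))
  simp only [Fintype.piFinset_univ] at h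
  have e : ∀ ρ : A → X, (∏ a, ζ a (ρ a)) * Real.exp (θ * ((B.filter fun b => f b (ρ b)).card : ℕ)) =
      ∏ a, (ζ a (ρ a) * (if a ∈ B then (if f a (ρ a) then Real.exp θ else 1) else 1)) := by
    intro ρ; rw [hexp, ← Finset.prod_mul_distrib]
  rw [Finset.sum_congr rfl fun ρ _ => e ρ, ← h]
  -- evaluate the block sums
  rw [← Finset.prod_filter_mul_prod_filter_not univ (fun a => a ∈ B)]
  have hin : ∏ a ∈ univ.filter (fun a => a ∈ B), ∑ x, ζ a x * (if a ∈ B then (if f a x then Real.exp θ else 1) else 1) =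
      ∏ b ∈ B, (1 + (∑ x ∈ univ.filter (fun x => f b x), ζ b x) * (Real.exp θ - 1)) := by
    have eB : univ.filter (fun a => a ∈ B) = B := by ext a; simp
    rw [eB]
    refine Finset.prod_congr rfl fun b hb => ?_
    simp only [if_pos hb]
    have split := Finset.sum_filter_add_sum_filter_not univ (fun x => f b x) (fun x => ζ b x * (if f b x then Real.exp θ else 1))
    rw [← split]
    have e1 : ∑ x ∈ univ.filter (fun x => f b x), ζ b x * (if f b x then Real.exp θ else 1) =
        (∑ x ∈ univ.filter (fun x => f b x), ζ b x) * Real.exp θ := by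
      rw [Finset.sum_mul]
      exact Finset.sum_congr rfl fun x hx => by rw [if_pos (Finset.mem_filter.1 hx).2]
    have e2 : ∑ x ∈ univ.filter (fun x => ¬ f b x), ζ b x * (if f b x then Real.exp θ else 1) =
        ∑ x ∈ univ.filter (fun x => ¬ f b x), ζ b x :=
      Finset.sum_congr rfl fun x hx => by rw [if_neg (Finset.mem_filter.1 hx).2, mul_one]
    have e3 : ∑ x ∈ univ.filter (fun x => ¬ f b x), ζ b x = 1 - ∑ x ∈ univ.filter (fun x => f b x), ζ b x := by
      have := Finset.sum_filter_add_sum_filter_not univ (fun x => f b x) (ζ b)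
      rw [hζ1 b] at this; linarith
    rw [e1, e2, e3]; ring
  have hout : ∏ a ∈ univ.filter (fun a => ¬ a ∈ B), ∑ x, ζ a x * (if a ∈ B then (if f a x then Real.exp θ else 1) else 1) = 1 :=
    Finset.prod_eq_one fun a ha => by
      have ha' : a ∉ B := (Finset.mem_filter.1 ha).2
      simp only [if_neg ha', mul_one]; exact hζ1 a
  rw [hin, hout, mul_one]

/-- **Independence of disjoint groups of blocks**: the same factorisation for events attached to
the groups `{(g, i) : i}` of a product weight on `G × I`-indexed blocks. [cite: RossmanServedioTan2015, §10.1 Lemmas 12, 15, 16 (pp. 32–34, gate values determined by disjoint sets of blocks are independent)] -/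
theorem mgf_count_groups {G I : Type*} [Fintype G] [DecidableEq G] [Fintype I] [DecidableEq I]
    (ζ : G × I → X → ℝ) (hζ1 : ∀ a, ∑ x, ζ a x = 1) (B : Finset G)
    (f : G → (I → X) → Prop) [∀ g xs, Decidable (f g xs)] (θ : ℝ) :
    ∑ ρ : G × I → X, (∏ a, ζ a (ρ a)) * Real.exp (θ * ((B.filter fun g => f g (fun i => ρ (g, i))).card : ℕ)) =
      ∏ g ∈ B, (1 + (∑ xs ∈ univ.filter (fun xs : I → X => f g xs), ∏ i, ζ (g, i) (xs i)) * (Real.exp θ - 1)) := by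
  classical
  -- the grouped weight is a product weight over `G` with block type `I → X`
  have hν1 : ∀ g : G, ∑ xs : I → X, ∏ i, ζ (g, i) (xs i) = 1 := by
    intro g
    have h := Finset.prod_univ_sum (fun (_ : I) => (univ : Finset X)) (fun i x => ζ (g, i) x)
    simp only [Fintype.piFinset_univ] at h
    rw [← h]; exact Finset.prod_eq_one fun i _ => hζ1 (g, i)
  have key := mgf_count_blocks (A := G) (X := I → X) (fun g xs => ∏ i, ζ (g, i) (xs i)) hν1 B f θ
  rw [← key, ← (Equiv.curry G I X).symm.sum_comp]
  refine Finset.sum_congr rfl fun ρc _ => ?_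
  congr 1
  · rw [Fintype.prod_prod_type]; rfl

end MGF

end RSTProj

end Literature.Computability.Complexity

end
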